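import Mathlib.Analysis.SpecialFunctions.Log.Deriv
import Mathlib.Analysis.SpecialFunctions.ExpDeriv
import Mathlib.Analysis.Calculus.ContDiff.WithLp
import Literature.Topology.FourManifolds.Cobordism
import Literature.Topology.FourManifolds.Handles
import Literature.Topology.FourManifolds.Morse
import Literature.Topology.FourManifolds.MorseChartChange
import HarnessLib

/-!
# A closed manifold as a cobordism from `∅` to `∅`

Topic `Literature/Topology/FourManifolds` (trunk FourManL, notion `kirby_calculus_handles`;
fact seat `provefact-Literature.SPC4.exists_isMorse_isSelfIndexing`).  Milnor, *Lectures on the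
h-cobordism theorem* (1965) states everything (§§3–8: gradient-like fields, rearrangement
Thm. 4.8, cancellation Thms. 5.4/6.4, §8) for *triads* `(W; V₀, V₁)`, a closed manifold being
the triad `(W; ∅, ∅)` (§1).  The tree vendors these results for its cobordisms
`Literature.Cobordism n M N` (`Cobordism.lean`: total space `c.W` charted on the half-space
`EuclideanHalfSpace (n + 1)`, model `𝓡∂ (n + 1)`), whereas the closed manifolds of
`SPC4Handles.lean` (b) are charted on `EuclideanSpace ℝ (Fin (n + 1))`, model `𝓡 (n + 1)`.  This
file bridges the two settings, so that the triad facts apply to closed manifolds: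

* `Literature.HalfSpaceCharted X` — the type synonym of a manifold `X` charted on `ℝⁿ⁺¹`, equipped
  with the half-space atlas obtained by following each chart with the diffeomorphism
  `expFirst : (t, u) ↦ (eᵗ, u)` of `ℝⁿ⁺¹ = ℝ × ℝⁿ` onto the open half-space `{x | x 0 > 0}`
  (`Literature.Topology.FourManifolds.HalfSpaceCharted.emb`; inverse `logFirst`).  It is a `C^∞` manifold for `𝓡∂ (n + 1)`
  (`instIsManifold`: transition maps `expFirst ∘ (ψ ∘ φ⁻¹) ∘ logFirst`) without boundary
  points (`instBoundarylessManifold`, `boundary_eq_empty`).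
* **Transfer of Morse data along the identity `of : X ≃ HalfSpaceCharted X`.**  For a
  function `f : X → F`: smoothness and differentiability are the same
  (`contMDiff_iff`, `mdifferentiableAt_iff`); the manifold derivative on the synonym is the
  one on `X` composed with `D(logFirst)` at the base point of the chart (`mfderiv_eq`), so
  critical points are the same (`isMCriticalPt_iff`, `criticalSet_eq`); at a critical point of a
  `C²` function the two chartwise Hessians (`Literature.Topology.FourManifolds.mhessian`, `Morse.lean`) are congruent by the
  invertible `D(logFirst)` (`mhessian_apply_eq`, second-order chain rule of
  `MorseChartChange.lean`), hence nondegeneracy and the Morse index agree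
  (`nondegenerate_mhessian_iff`, `morseIndex_eq`), `IsMorse` is the same (`isMorse_iff`) and so
  are the critical points of each index and their number (`criticalSetOfIndex_eq`,
  `ncard_criticalSetOfIndex_eq`).  (Milnor 1963, §2: these notions do not depend on the
  coordinate system.)
* `Literature.Cobordism.ofClosed n X : Cobordism n PEmpty PEmpty` — the closed `(n+1)`-manifold `X`
  as the triad `(X; ∅, ∅)`, total space `HalfSpaceCharted X`; and
  `Literature.Topology.FourManifolds.Cobordism.isMorseFunction_ofClosed_iff`: the tree's Morse functions on this cobordism
  (`Literature.Topology.FourManifolds.Cobordism.IsMorseFunction`) are exactly the Morse functions on `X` with values in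
  `(0, 1)`.

Consumers: `NiceMorseFunctionsRearrangement.lean` (Milnor's Thm. 4.8 for closed manifolds from
the triad version) and `MorseBridgingPair.lean` (cancellation of a superfluous minimum).

## Design notes

* A global diffeomorphism `ℝ ≅ (0, ∞)` in the first coordinate is needed because chart
  targets are arbitrary open subsets of `ℝⁿ⁺¹`; `exp`/`log` keep all maps explicit and `C^∞`
  (indeed the atlas is compatible to every order `k : ℕ∞ω`).
* Statements are phrased with `f ∘ of.symm : HalfSpaceCharted X → F` for `f : X → F`
  (`of = Equiv.refl`), which fixes the charted-space instances by the type of the function.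
  The total space `(Cobordism.ofClosed n X).W` is `HalfSpaceCharted X` by `rfl`, but only up to
  unfolding the definition: consumers restate conclusions obtained on `c.W` at the type
  `HalfSpaceCharted X` (by `have … := h`) before rewriting.
* `mfderiv_eq` is stated between `𝔼 (n + 1) →L[ℝ] F`-valued expressions (the tangent spaces
  of both structures are `𝔼 (n + 1)` by definition).

## References

* J. Milnor, *Lectures on the h-cobordism theorem*, Princeton Math. Notes (1965), §1 (triads
  `(W; V₀, V₁)`; closed manifolds as `(W; ∅, ∅)`), Def. 3.1. [MilnorHCobordism1965]
* J. Milnor, *Morse theory*, Ann. of Math. Studies 51 (1963), §2 (critical points,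
  nondegeneracy and index are independent of coordinates). [Milnor1963]
-/

open scoped Manifold ContDiff Topology
open Set Function Filter

noncomputable section

namespace Literature.Topology.FourManifolds

universe u

/-- Local notation: `𝔼 n` is the model Euclidean space `EuclideanSpace ℝ (Fin n)`. -/
local notation "𝔼 " n:arg => EuclideanSpace ℝ (Fin n)

namespace HalfSpaceCharted

open BoundaryManifold

/-! ### The diffeomorphism `ℝⁿ⁺¹ ≅ {x | x 0 > 0}`, `(t, u) ↦ (eᵗ, u)` -/

variable (n : ℕ)

/-- The map `(t, u) ↦ (exp t, u)` of `ℝⁿ⁺¹ = ℝ × ℝⁿ` onto the open half-space `{x | 0 < x 0}`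
(first coordinate exponentiated, the others unchanged). [folklore] -/
def expFirst (x : 𝔼 (n + 1)) : 𝔼 (n + 1) := consCLE n (tail n x, Real.exp (x 0))

/-- The map `(s, u) ↦ (log s, u)`, inverse to `expFirst` on the open half-space `{x | 0 < x 0}`.
[folklore] -/
def logFirst (x : 𝔼 (n + 1)) : 𝔼 (n + 1) := consCLE n (tail n x, Real.log (x 0))

/-- The first coordinate of `expFirst x` is `exp (x 0)`. [folklore] -/
@[simp] theorem expFirst_apply_zero (x : 𝔼 (n + 1)) : expFirst n x 0 = Real.exp (x 0) := rfl

/-- The first coordinate of `logFirst x` is `log (x 0)`. [folklore] -/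
@[simp] theorem logFirst_apply_zero (x : 𝔼 (n + 1)) : logFirst n x 0 = Real.log (x 0) := rfl

/-- `expFirst` does not change the other coordinates. [folklore] -/
@[simp] theorem tail_expFirst (x : 𝔼 (n + 1)) : tail n (expFirst n x) = tail n x := by
  simp [expFirst]

/-- `logFirst` does not change the other coordinates. [folklore] -/
@[simp] theorem tail_logFirst (x : 𝔼 (n + 1)) : tail n (logFirst n x) = tail n x := by
  simp [logFirst]

/-- `expFirst` lands in the open half-space `{x | 0 < x 0}`. [folklore] -/
theorem expFirst_apply_zero_pos (x : 𝔼 (n + 1)) : 0 < expFirst n x 0 := Real.exp_pos _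

/-- `logFirst` is a left inverse of `expFirst`. [folklore] -/
@[simp] theorem logFirst_expFirst (x : 𝔼 (n + 1)) : logFirst n (expFirst n x) = x := by
  rw [logFirst, tail_expFirst, expFirst_apply_zero, Real.log_exp, consCLE_tail]

/-- `expFirst` inverts `logFirst` on the open half-space. [folklore] -/
theorem expFirst_logFirst {x : 𝔼 (n + 1)} (hx : 0 < x 0) : expFirst n (logFirst n x) = x := by
  rw [expFirst, tail_logFirst, logFirst_apply_zero, Real.exp_log hx, consCLE_tail]

/-- The first coordinate is smooth. [folklore] -/
theorem contDiff_apply_zero {k : ℕ∞ω} : ContDiff ℝ k (fun x : 𝔼 (n + 1) => x 0) :=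
  contDiff_piLp_apply (p := 2) (i := (0 : Fin (n + 1)))

/-- `tail` is `Cᵏ` for every `k` (the tree's `contDiff_tail` is the case `k = ∞`). [folklore] -/
theorem contDiff_tail' {k : ℕ∞ω} : ContDiff ℝ k (tail n) :=
  contDiff_fst.comp (consCLE n).symm.contDiff

/-- `expFirst` is smooth. [folklore] -/
theorem contDiff_expFirst {k : ℕ∞ω} : ContDiff ℝ k (expFirst n) :=
  (consCLE n).contDiff.comp <| (contDiff_tail' n).prodMk <|
    Real.contDiff_exp.comp (contDiff_apply_zero n)

/-- `logFirst` is smooth at points with nonzero first coordinate. [folklore] -/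
theorem contDiffAt_logFirst {k : ℕ∞ω} {x : 𝔼 (n + 1)} (hx : x 0 ≠ 0) :
    ContDiffAt ℝ k (logFirst n) x := by
  have h1 : ContDiffAt ℝ k (fun y : 𝔼 (n + 1) => Real.log (y 0)) x :=
    ContDiffAt.comp (g := Real.log) x (Real.contDiffAt_log.2 hx) (contDiff_apply_zero n).contDiffAt
  exact (consCLE n).contDiff.contDiffAt.comp x ((contDiff_tail' n).contDiffAt.prodMk h1)

/-- `logFirst` is smooth on the open half-space. [folklore] -/
theorem contDiffOn_logFirst {k : ℕ∞ω} : ContDiffOn ℝ k (logFirst n) {x | 0 < x 0} := fun _ hx =>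
  (contDiffAt_logFirst n (ne_of_gt hx)).contDiffWithinAt

/-- `expFirst` is continuous. [folklore] -/
theorem continuous_expFirst : Continuous (expFirst n) :=
  (contDiff_expFirst n (k := 0)).continuous

/-- `logFirst` is continuous on the open half-space. [folklore] -/
theorem continuousOn_logFirst : ContinuousOn (logFirst n) {x | 0 < x 0} :=
  (contDiffOn_logFirst n (k := 0)).continuousOn

/-- The open half-space `{x | 0 < x 0}` is open. [folklore] -/
theorem isOpen_setOf_apply_zero_pos : IsOpen {x : 𝔼 (n + 1) | 0 < x 0} :=
  isOpen_lt continuous_const (contDiff_apply_zero n (k := 0)).continuous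

/-- `expFirst` as an open partial homeomorphism of `ℝⁿ⁺¹` onto the open subset `{x | 0 < x 0}`
of the closed half-space `EuclideanHalfSpace (n + 1)`. [folklore] -/
def emb : OpenPartialHomeomorph (𝔼 (n + 1)) (EuclideanHalfSpace (n + 1)) where
  toFun x := ⟨expFirst n x, (expFirst_apply_zero_pos n x).le⟩
  invFun p := logFirst n p.val
  source := univ
  target := {p | 0 < p.val 0}
  map_source' x _ := expFirst_apply_zero_pos n x
  map_target' _ _ := mem_univ _
  left_inv' x _ := logFirst_expFirst n x
  right_inv' _ hp := Subtype.ext (expFirst_logFirst n hp)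
  open_source := isOpen_univ
  open_target := (isOpen_setOf_apply_zero_pos n).preimage continuous_subtype_val
  continuousOn_toFun := ((continuous_expFirst n).subtype_mk _).continuousOn
  continuousOn_invFun := (continuousOn_logFirst n).comp continuous_subtype_val.continuousOn
    fun _ hp => hp

/-- `emb` is defined everywhere. [folklore] -/
@[simp] theorem emb_source : (emb n).source = univ := rfl

/-- The target of `emb` is the open half-space. [folklore] -/
theorem emb_target : (emb n).target = {p | 0 < p.val 0} := rfl

/-- `emb` is `expFirst` followed by the inclusion into the half-space. [folklore] -/
@[simp] theorem emb_apply_val (x : 𝔼 (n + 1)) : (emb n x).val = expFirst n x := rfl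

/-- The inverse of `emb` is `logFirst` on the underlying vector. [folklore] -/
@[simp] theorem emb_symm_apply (p : EuclideanHalfSpace (n + 1)) : (emb n).symm p = logFirst n p.val :=
  rfl

/-- Read through the model with corners `𝓡∂ (n + 1)`, `emb` is `expFirst`. [folklore] -/
theorem modelWithCorners_emb (x : 𝔼 (n + 1)) : (𝓡∂ (n + 1)) (emb n x) = expFirst n x := rfl

end HalfSpaceCharted

/-! ### The type synonym and its half-space charts -/

/-- `HalfSpaceCharted X` is the manifold `X` itself, to be equipped with charts valued in the
closed half-space (a manifold "with boundary" whose boundary is empty). [folklore] -/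
def HalfSpaceCharted (X : Type u) : Type u := X

namespace HalfSpaceCharted

variable {n : ℕ} {X : Type u}

/-- The identity `X → HalfSpaceCharted X`. [folklore] -/
def of : X ≃ HalfSpaceCharted X := Equiv.refl X

/-- The synonym carries the topology of `X`. [folklore] -/
instance [TopologicalSpace X] : TopologicalSpace (HalfSpaceCharted X) := ‹TopologicalSpace X›
/-- The synonym is Hausdorff when `X` is. [folklore] -/
instance [TopologicalSpace X] [T2Space X] : T2Space (HalfSpaceCharted X) := ‹T2Space X›
/-- The synonym is compact when `X` is. [folklore] -/
instance [TopologicalSpace X] [CompactSpace X] : CompactSpace (HalfSpaceCharted X) := ‹CompactSpace X›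
/-- The synonym is second countable when `X` is. [folklore] -/
instance [TopologicalSpace X] [SecondCountableTopology X] :
    SecondCountableTopology (HalfSpaceCharted X) := ‹SecondCountableTopology X›
/-- The synonym is connected when `X` is. [folklore] -/
instance [TopologicalSpace X] [ConnectedSpace X] : ConnectedSpace (HalfSpaceCharted X) :=
  ‹ConnectedSpace X›
/-- The synonym is nonempty when `X` is. [folklore] -/
instance [Nonempty X] : Nonempty (HalfSpaceCharted X) := ‹Nonempty X›

variable [TopologicalSpace X] [ChartedSpace (𝔼 (n + 1)) X]

/-- The half-space atlas: each chart `φ` of `X` followed by `(t, u) ↦ (eᵗ, u)`. [folklore] -/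
instance instChartedSpace : ChartedSpace (EuclideanHalfSpace (n + 1)) (HalfSpaceCharted X) where
  atlas := (fun φ => φ.trans (emb n)) '' atlas (𝔼 (n + 1)) X
  chartAt p := (chartAt (𝔼 (n + 1)) (of.symm p)).trans (emb n)
  mem_chart_source p := by
    simp only [OpenPartialHomeomorph.trans_source, emb_source, preimage_univ, inter_univ]
    exact mem_chart_source (𝔼 (n + 1)) (of.symm p)
  chart_mem_atlas p := mem_image_of_mem _ (chart_mem_atlas _ _)

/-- The preferred half-space chart at `p` is the preferred chart of `X` followed by `emb`. [folklore] -/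
theorem chartAt_eq (p : HalfSpaceCharted X) :
    chartAt (EuclideanHalfSpace (n + 1)) p = (chartAt (𝔼 (n + 1)) (of.symm p)).trans (emb n) := rfl

/-- Membership in the half-space atlas. [folklore] -/
theorem mem_atlas_iff {e : OpenPartialHomeomorph (HalfSpaceCharted X) (EuclideanHalfSpace (n + 1))} :
    e ∈ atlas (EuclideanHalfSpace (n + 1)) (HalfSpaceCharted X) ↔
      ∃ φ ∈ atlas (𝔼 (n + 1)) X, φ.trans (emb n) = e := Iff.rfl

/-- The value of the model with corners on a point of the range is recovered by `val`. [folklore] -/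
theorem val_modelWithCorners_symm {u : 𝔼 (n + 1)} (hu : u ∈ range (𝓡∂ (n + 1))) :
    ((𝓡∂ (n + 1)).symm u).val = u :=
  (𝓡∂ (n + 1)).right_inv hu

/-- Points of the range of `𝓡∂ (n + 1)` have nonnegative first coordinate. [folklore] -/
theorem apply_zero_nonneg_of_mem_range {u : 𝔼 (n + 1)} (hu : u ∈ range (𝓡∂ (n + 1))) : 0 ≤ u 0 := by
  rw [range_modelWithCornersEuclideanHalfSpace] at hu; exact hu

/-- Transition maps of `X` are smooth (the `C^∞` structure of `X`, read without the trivial model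
with corners `𝓡 (n + 1)`). [folklore] -/
theorem contDiffOn_coordChange [IsManifold (𝓡 (n + 1)) ∞ X]
    {φ ψ : OpenPartialHomeomorph X (𝔼 (n + 1))} (hφ : φ ∈ atlas (𝔼 (n + 1)) X)
    (hψ : ψ ∈ atlas (𝔼 (n + 1)) X) :
    ContDiffOn ℝ ∞ (ψ ∘ φ.symm) (φ.target ∩ φ.symm ⁻¹' ψ.source) := by
  have h := (mem_groupoid_of_pregroupoid.1
    (HasGroupoid.compatible (G := contDiffGroupoid ∞ (𝓡 (n + 1))) hφ hψ)).1
  simpa [contDiffPregroupoid, mfld_simps] using h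

/-- **`HalfSpaceCharted X` is a `C^∞` manifold with boundary (modelled on `𝓡∂ (n + 1)`).**  The
transition map of two half-space charts `φ ≫ emb`, `ψ ≫ emb` is `expFirst ∘ (ψ ∘ φ⁻¹) ∘ logFirst`
on an open subset of the open half-space, smooth. [folklore] -/
instance instIsManifold [IsManifold (𝓡 (n + 1)) ∞ X] :
    IsManifold (𝓡∂ (n + 1)) ∞ (HalfSpaceCharted X) := by
  apply isManifold_of_contDiffOn
  rintro e e' ⟨φ, hφ, rfl⟩ ⟨ψ, hψ, rfl⟩
  have hF : ContDiffOn ℝ ∞ (expFirst n ∘ (ψ ∘ φ.symm) ∘ logFirst n)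
      ({u | 0 < u 0} ∩ logFirst n ⁻¹' (φ.target ∩ φ.symm ⁻¹' ψ.source)) :=
    (contDiff_expFirst n).comp_contDiffOn
      ((contDiffOn_coordChange hφ hψ).comp ((contDiffOn_logFirst n).mono inter_subset_left)
        fun u hu => hu.2)
  refine hF.congr_mono ?_ ?_
  · rintro u ⟨hu, hur⟩
    have hval := val_modelWithCorners_symm hur
    show (expFirst n (ψ (φ.symm (logFirst n ((𝓡∂ (n + 1)).symm u).val)))) = _
    rw [hval]
    rfl
  · rintro u ⟨hu, hur⟩
    have hval := val_modelWithCorners_symm hur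
    simp only [mem_preimage, OpenPartialHomeomorph.trans_source, OpenPartialHomeomorph.symm_source,
      OpenPartialHomeomorph.trans_target, emb_target, mem_inter_iff, mem_setOf_eq,
      emb_source, preimage_univ, inter_univ] at hu
    refine ⟨?_, ?_, ?_⟩
    · have h := hu.1.1
      rwa [hval] at h
    · have h := hu.1.2
      rwa [emb_symm_apply, hval] at h
    · have h := hu.2
      change φ.symm (logFirst n ((𝓡∂ (n + 1)).symm u).val) ∈ ψ.source at h
      rwa [hval] at h

/-! ### Every point is an interior point -/

/-- `HalfSpaceCharted X` has no boundary points: the preferred extended chart sends `p` to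
`expFirst _`, whose first coordinate `exp _` is positive. [folklore] -/
instance instBoundarylessManifold : BoundarylessManifold (𝓡∂ (n + 1)) (HalfSpaceCharted X) where
  isInteriorPoint' p := by
    show extChartAt (𝓡∂ (n + 1)) p p ∈ interior (range (𝓡∂ (n + 1)))
    rw [interior_range_modelWithCornersEuclideanHalfSpace]
    exact expFirst_apply_zero_pos n _

/-- `HalfSpaceCharted X` has empty boundary. [folklore] -/
theorem boundary_eq_empty : (𝓡∂ (n + 1)).boundary (HalfSpaceCharted X) = ∅ :=
  ModelWithCorners.Boundaryless.boundary_eq_empty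

/-- Every point of `HalfSpaceCharted X` is an interior point. [folklore] -/
theorem interior_eq_univ : (𝓡∂ (n + 1)).interior (HalfSpaceCharted X) = univ :=
  ModelWithCorners.interior_eq_univ

/-! ### Extended charts of the synonym -/

/-- The half-space extended chart at `of p` is the extended chart of `X` at `p` followed by
`expFirst`. [folklore] -/
theorem extChartAt_apply (p q : X) :
    extChartAt (𝓡∂ (n + 1)) (of p) (of q) = expFirst n (extChartAt (𝓡 (n + 1)) p q) := rfl

/-- The half-space extended charts take values in the open half-space. [folklore] -/
theorem extChartAt_apply_zero_pos (p q : X) : 0 < extChartAt (𝓡∂ (n + 1)) (of p) (of q) 0 :=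
  expFirst_apply_zero_pos n _

/-- `logFirst` undoes the half-space extended chart down to the extended chart of `X`. [folklore] -/
theorem logFirst_extChartAt (p q : X) :
    logFirst n (extChartAt (𝓡∂ (n + 1)) (of p) (of q)) = extChartAt (𝓡 (n + 1)) p q := by
  rw [extChartAt_apply, logFirst_expFirst]

/-- The inverse half-space extended chart on the closed half-space, in terms of the inverse
extended chart of `X` and `logFirst`. [folklore] -/
theorem extChartAt_symm_apply_of_nonneg (p : X) {u : 𝔼 (n + 1)} (hu : 0 ≤ u 0) :
    (extChartAt (𝓡∂ (n + 1)) (of p)).symm u =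
      of ((extChartAt (𝓡 (n + 1)) p).symm (logFirst n u)) := by
  have hur : u ∈ range (𝓡∂ (n + 1)) := by
    rw [range_modelWithCornersEuclideanHalfSpace]; exact hu
  show (chartAt (𝔼 (n + 1)) p).symm (logFirst n ((𝓡∂ (n + 1)).symm u).val) = _
  rw [val_modelWithCorners_symm hur]
  rfl

/-- The open half-space is a neighbourhood of the base point of a half-space extended chart. [folklore] -/
theorem setOf_apply_zero_pos_mem_nhds (p : X) :
    {u : 𝔼 (n + 1) | 0 < u 0} ∈ 𝓝 (extChartAt (𝓡∂ (n + 1)) (of p) (of p)) :=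
  (isOpen_setOf_apply_zero_pos n).mem_nhds (extChartAt_apply_zero_pos p p)

/-- The closed half-space is a neighbourhood of the base point of a half-space extended chart
(an interior point). [folklore] -/
theorem range_mem_nhds (p : X) :
    range (𝓡∂ (n + 1)) ∈ 𝓝 (extChartAt (𝓡∂ (n + 1)) (of p) (of p)) :=
  range_mem_nhds_isInteriorPoint BoundarylessManifold.isInteriorPoint

/-- A function on the synonym read in its extended chart at `p` is, near the base point, the
function read in the extended chart of `X` at `p`, precomposed with `logFirst`. [folklore] -/
theorem comp_extChartAt_symm_eventuallyEq {α : Type*} (g : X → α) (p : X) :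
    (g ∘ of.symm) ∘ (extChartAt (𝓡∂ (n + 1)) (of p)).symm =ᶠ[𝓝 (extChartAt (𝓡∂ (n + 1)) (of p) (of p))]
      (g ∘ (extChartAt (𝓡 (n + 1)) p).symm) ∘ logFirst n := by
  filter_upwards [setOf_apply_zero_pos_mem_nhds p] with u hu
  simp only [comp_apply, extChartAt_symm_apply_of_nonneg p (le_of_lt hu)]
  rfl

/-! ### Transfer of differentiability of functions -/

section Functions

variable {F : Type*} [NormedAddCommGroup F] [NormedSpace ℝ F]

/-- `ContDiffAt` is invariant under eventual equality (both directions of Mathlib's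
`ContDiffAt.congr_of_eventuallyEq`). [folklore] -/
theorem contDiffAt_congr_of_eventuallyEq {k : ℕ∞ω} {G G' : 𝔼 (n + 1) → F} {u : 𝔼 (n + 1)}
    (h : G =ᶠ[𝓝 u] G') : ContDiffAt ℝ k G u ↔ ContDiffAt ℝ k G' u :=
  ⟨fun H => H.congr_of_eventuallyEq h.symm, fun H => H.congr_of_eventuallyEq h⟩

/-- A vector-valued function on `X` written in the extended chart at `p`. [folklore] -/
theorem writtenInExtChartAt_eq (f : X → F) (p : X) :
    writtenInExtChartAt (𝓡 (n + 1)) 𝓘(ℝ, F) p f = f ∘ (extChartAt (𝓡 (n + 1)) p).symm := by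
  ext u; simp [writtenInExtChartAt]

/-- A vector-valued function on the synonym written in the half-space extended chart at `of p`. [folklore] -/
theorem writtenInExtChartAt_eq' (f : X → F) (p : X) :
    writtenInExtChartAt (𝓡∂ (n + 1)) 𝓘(ℝ, F) (of p) (f ∘ of.symm) =
      (f ∘ of.symm) ∘ (extChartAt (𝓡∂ (n + 1)) (of p)).symm := by
  ext u; simp [writtenInExtChartAt]

/-- For a function on `ℝⁿ⁺¹`, being `Cᵏ` at `u` is being `Cᵏ` at `expFirst u` after
precomposition with `logFirst`. [folklore] -/
theorem contDiffAt_comp_logFirst_iff {k : ℕ∞ω} {G : 𝔼 (n + 1) → F} {u : 𝔼 (n + 1)} :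
    ContDiffAt ℝ k (G ∘ logFirst n) (expFirst n u) ↔ ContDiffAt ℝ k G u := by
  constructor
  · intro h
    have h' := h.comp u (contDiff_expFirst n).contDiffAt
    have heq : (G ∘ logFirst n) ∘ expFirst n = G := by
      ext v; simp
    rwa [heq] at h'
  · intro h
    refine ContDiffAt.comp (expFirst n u) ?_ (contDiffAt_logFirst n (expFirst_apply_zero_pos n u).ne')
    rwa [logFirst_expFirst]

/-- Same for differentiability. [folklore] -/
theorem differentiableAt_comp_logFirst_iff {G : 𝔼 (n + 1) → F} {u : 𝔼 (n + 1)} :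
    DifferentiableAt ℝ (G ∘ logFirst n) (expFirst n u) ↔ DifferentiableAt ℝ G u := by
  constructor
  · intro h
    have h' := h.comp u ((contDiff_expFirst n (k := 1)).differentiable one_ne_zero).differentiableAt
    have heq : (G ∘ logFirst n) ∘ expFirst n = G := by
      ext v; simp
    rwa [heq] at h'
  · intro h
    refine DifferentiableAt.comp (expFirst n u) ?_
      ((contDiffAt_logFirst n (k := 1) (expFirst_apply_zero_pos n u).ne').differentiableAt one_ne_zero)
    rwa [logFirst_expFirst]

/-- **Smoothness of functions is the same for `X` and for `HalfSpaceCharted X`.** [folklore] -/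
theorem contMDiffAt_iff {k : ℕ∞ω} {f : X → F} {p : X} :
    ContMDiffAt (𝓡∂ (n + 1)) 𝓘(ℝ, F) k (f ∘ of.symm) (of p) ↔
      ContMDiffAt (𝓡 (n + 1)) 𝓘(ℝ, F) k f p := by
  rw [_root_.contMDiffAt_iff, _root_.contMDiffAt_iff]
  have hc : ContinuousAt (f ∘ of.symm) (of p) ↔ ContinuousAt f p := Iff.rfl
  rw [hc]
  refine and_congr_right fun _ => ?_
  simp only [extChartAt_model_space_eq_id, PartialEquiv.refl_coe, id_comp,
    ModelWithCorners.Boundaryless.range_eq_univ (I := 𝓡 (n + 1)), contDiffWithinAt_univ]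
  rw [contDiffWithinAt_iff_contDiffAt (range_mem_nhds p),
    contDiffAt_congr_of_eventuallyEq (comp_extChartAt_symm_eventuallyEq f p), extChartAt_apply,
    contDiffAt_comp_logFirst_iff]

/-- **Global smoothness of functions is the same for `X` and for `HalfSpaceCharted X`.** [folklore] -/
theorem contMDiff_iff {k : ℕ∞ω} {f : X → F} :
    ContMDiff (𝓡∂ (n + 1)) 𝓘(ℝ, F) k (f ∘ of.symm) ↔ ContMDiff (𝓡 (n + 1)) 𝓘(ℝ, F) k f :=
  ⟨fun h p => contMDiffAt_iff.1 (h (of p)), fun h p => contMDiffAt_iff.2 (h (of.symm p))⟩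

/-- **Differentiability of functions is the same for `X` and for `HalfSpaceCharted X`.** [folklore] -/
theorem mdifferentiableAt_iff {f : X → F} {p : X} :
    MDifferentiableAt (𝓡∂ (n + 1)) 𝓘(ℝ, F) (f ∘ of.symm) (of p) ↔
      MDifferentiableAt (𝓡 (n + 1)) 𝓘(ℝ, F) f p := by
  rw [_root_.mdifferentiableAt_iff, _root_.mdifferentiableAt_iff]
  have hc : ContinuousAt (f ∘ of.symm) (of p) ↔ ContinuousAt f p := Iff.rfl
  rw [hc]
  refine and_congr_right fun _ => ?_
  rw [writtenInExtChartAt_eq, writtenInExtChartAt_eq',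
    ModelWithCorners.Boundaryless.range_eq_univ (I := 𝓡 (n + 1)), differentiableWithinAt_univ]
  constructor
  · intro h
    have h1 := h.differentiableAt (range_mem_nhds p)
    rw [(comp_extChartAt_symm_eventuallyEq f p).differentiableAt_iff, extChartAt_apply] at h1
    exact differentiableAt_comp_logFirst_iff.1 h1
  · intro h
    refine DifferentiableAt.differentiableWithinAt ?_
    rw [(comp_extChartAt_symm_eventuallyEq f p).differentiableAt_iff, extChartAt_apply]
    exact differentiableAt_comp_logFirst_iff.2 h

/-- A `Cᵏ` function on `X` read in the extended chart at `p` is `Cᵏ` at the base point. [folklore] -/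
theorem contDiffAt_comp_extChartAt_symm {k : ℕ∞ω} {f : X → F} {p : X}
    (hf : ContMDiffAt (𝓡 (n + 1)) 𝓘(ℝ, F) k f p) :
    ContDiffAt ℝ k (f ∘ (extChartAt (𝓡 (n + 1)) p).symm) (extChartAt (𝓡 (n + 1)) p p) := by
  have h := (_root_.contMDiffAt_iff.1 hf).2
  simpa only [extChartAt_model_space_eq_id, PartialEquiv.refl_coe, id_comp,
    ModelWithCorners.Boundaryless.range_eq_univ (I := 𝓡 (n + 1)), contDiffWithinAt_univ] using h

/-- A differentiable function on `X` read in the extended chart at `p` is differentiable at the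
base point. [folklore] -/
theorem differentiableAt_comp_extChartAt_symm {f : X → F} {p : X}
    (hf : MDifferentiableAt (𝓡 (n + 1)) 𝓘(ℝ, F) f p) :
    DifferentiableAt ℝ (f ∘ (extChartAt (𝓡 (n + 1)) p).symm) (extChartAt (𝓡 (n + 1)) p p) := by
  have h := (_root_.mdifferentiableAt_iff _ _).1 hf |>.2
  rwa [writtenInExtChartAt_eq, ModelWithCorners.Boundaryless.range_eq_univ (I := 𝓡 (n + 1)),
    differentiableWithinAt_univ] at h

/-- On `X` (trivial model with corners) the manifold derivative of a differentiable function is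
the Fréchet derivative of the function read in the extended chart. [folklore] -/
theorem mfderiv_eq_fderiv {f : X → F} {p : X} (hf : MDifferentiableAt (𝓡 (n + 1)) 𝓘(ℝ, F) f p) :
    mfderiv (𝓡 (n + 1)) 𝓘(ℝ, F) f p =
      fderiv ℝ (f ∘ (extChartAt (𝓡 (n + 1)) p).symm) (extChartAt (𝓡 (n + 1)) p p) := by
  rw [hf.mfderiv, writtenInExtChartAt_eq,
    ModelWithCorners.Boundaryless.range_eq_univ (I := 𝓡 (n + 1)), fderivWithin_univ]

/-- **The manifold derivative on the synonym** is the manifold derivative on `X` composed with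
the derivative of `logFirst` at the base point of the half-space chart (the differential of the
identity map `HalfSpaceCharted X → X` read in the two preferred charts). [folklore] -/
theorem mfderiv_eq (f : X → F) (p : X) :
    (mfderiv (𝓡∂ (n + 1)) 𝓘(ℝ, F) (f ∘ of.symm) (of p) : 𝔼 (n + 1) →L[ℝ] F) =
      ContinuousLinearMap.comp (mfderiv (𝓡 (n + 1)) 𝓘(ℝ, F) f p : 𝔼 (n + 1) →L[ℝ] F)
        (fderiv ℝ (logFirst n) (extChartAt (𝓡∂ (n + 1)) (of p) (of p)) :
          𝔼 (n + 1) →L[ℝ] 𝔼 (n + 1)) := by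
  by_cases hd : MDifferentiableAt (𝓡 (n + 1)) 𝓘(ℝ, F) f p
  · have hd' := mdifferentiableAt_iff.2 hd
    have hG := differentiableAt_comp_extChartAt_symm hd
    rw [hd'.mfderiv, mfderiv_eq_fderiv hd, writtenInExtChartAt_eq',
      fderivWithin_of_mem_nhds (range_mem_nhds p), (comp_extChartAt_symm_eventuallyEq f p).fderiv_eq,
      extChartAt_apply]
    rw [← logFirst_expFirst n (extChartAt (𝓡 (n + 1)) p p)] at hG
    rw [fderiv_comp _ hG ((contDiffAt_logFirst n (k := 1)
      (expFirst_apply_zero_pos n _).ne').differentiableAt one_ne_zero), logFirst_expFirst]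
    rfl
  · rw [mfderiv_zero_of_not_mdifferentiableAt hd,
      mfderiv_zero_of_not_mdifferentiableAt (mt mdifferentiableAt_iff.1 hd),
      ContinuousLinearMap.zero_comp]
    rfl

/-- The derivative of `logFirst` at a point of the open half-space, as a continuous linear
automorphism of `ℝⁿ⁺¹` (inverse: the derivative of `expFirst`). [folklore] -/
def fderivLogFirst (n : ℕ) (u : 𝔼 (n + 1)) (hu : 0 < u 0) : 𝔼 (n + 1) ≃L[ℝ] 𝔼 (n + 1) :=
  ContinuousLinearEquiv.equivOfInverse (fderiv ℝ (logFirst n) u)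
    (fderiv ℝ (expFirst n) (logFirst n u))
    (by
      intro v
      have hexp : DifferentiableAt ℝ (expFirst n) (logFirst n u) :=
        ((contDiff_expFirst n (k := 1)).differentiable one_ne_zero).differentiableAt
      have hlog : DifferentiableAt ℝ (logFirst n) u :=
        (contDiffAt_logFirst n (k := 1) hu.ne').differentiableAt one_ne_zero
      have hcomp := fderiv_comp u hexp hlog
      have hid : expFirst n ∘ logFirst n =ᶠ[𝓝 u] id := by
        filter_upwards [(isOpen_setOf_apply_zero_pos n).mem_nhds hu] with v hv
        exact expFirst_logFirst n hv
      rw [hid.fderiv_eq, fderiv_id] at hcomp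
      have := congrArg (fun L : 𝔼 (n + 1) →L[ℝ] 𝔼 (n + 1) => L v) hcomp
      simpa using this.symm)
    (by
      intro v
      have hexp : DifferentiableAt ℝ (expFirst n) (logFirst n u) :=
        ((contDiff_expFirst n (k := 1)).differentiable one_ne_zero).differentiableAt
      have hlog : DifferentiableAt ℝ (logFirst n) (expFirst n (logFirst n u)) := by
        rw [expFirst_logFirst n hu]
        exact (contDiffAt_logFirst n (k := 1) hu.ne').differentiableAt one_ne_zero
      have hcomp := fderiv_comp (logFirst n u) hlog hexp
      have hid : logFirst n ∘ expFirst n = id := funext (logFirst_expFirst n)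
      rw [hid, fderiv_id, expFirst_logFirst n hu] at hcomp
      have := congrArg (fun L : 𝔼 (n + 1) →L[ℝ] 𝔼 (n + 1) => L v) hcomp
      simpa using this.symm)

/-- `fderivLogFirst` is the derivative of `logFirst`, as a continuous linear map. [folklore] -/
@[simp] theorem coe_fderivLogFirst (n : ℕ) (u : 𝔼 (n + 1)) (hu : 0 < u 0) :
    (fderivLogFirst n u hu : 𝔼 (n + 1) →L[ℝ] 𝔼 (n + 1)) = fderiv ℝ (logFirst n) u := rfl

/-- `fderivLogFirst` applied to a vector. [folklore] -/
theorem fderivLogFirst_apply (n : ℕ) (u : 𝔼 (n + 1)) (hu : 0 < u 0) (v : 𝔼 (n + 1)) :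
    fderivLogFirst n u hu v = fderiv ℝ (logFirst n) u v := rfl

end Functions

/-! ### Transfer of Morse data: critical points, Hessians, indices -/

section Morse

variable {f : X → ℝ} {p : X}

/-- **Critical points are the same for `X` and for `HalfSpaceCharted X`.** [folklore] -/
theorem isMCriticalPt_iff : IsMCriticalPt (𝓡∂ (n + 1)) (f ∘ of.symm) (of p) ↔
    IsMCriticalPt (𝓡 (n + 1)) f p := by
  have key := mfderiv_eq (n := n) (F := ℝ) f p
  show (mfderiv (𝓡∂ (n + 1)) 𝓘(ℝ, ℝ) (f ∘ of.symm) (of p) : 𝔼 (n + 1) →L[ℝ] ℝ) = 0 ↔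
    (mfderiv (𝓡 (n + 1)) 𝓘(ℝ, ℝ) f p : 𝔼 (n + 1) →L[ℝ] ℝ) = 0
  set A : 𝔼 (n + 1) →L[ℝ] ℝ := mfderiv (𝓡 (n + 1)) 𝓘(ℝ, ℝ) f p
  set A' : 𝔼 (n + 1) →L[ℝ] ℝ := mfderiv (𝓡∂ (n + 1)) 𝓘(ℝ, ℝ) (f ∘ of.symm) (of p)
  set L := fderivLogFirst n _ (extChartAt_apply_zero_pos p p)
  have key' : A' = A.comp (L : 𝔼 (n + 1) →L[ℝ] 𝔼 (n + 1)) := key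
  constructor
  · intro h
    have hA : A = (A.comp (L : 𝔼 (n + 1) →L[ℝ] 𝔼 (n + 1))).comp
        (L.symm : 𝔼 (n + 1) →L[ℝ] 𝔼 (n + 1)) := by
      rw [ContinuousLinearMap.comp_assoc, ContinuousLinearEquiv.coe_comp_coe_symm,
        ContinuousLinearMap.comp_id]
    rw [hA, ← key', h]
    exact ContinuousLinearMap.zero_comp _
  · intro h
    rw [key', h]
    exact ContinuousLinearMap.zero_comp _

variable (f) in
/-- The critical sets correspond under the identification `of : X ≃ HalfSpaceCharted X`. [folklore] -/
theorem criticalSet_eq : criticalSet (𝓡∂ (n + 1)) (f ∘ of.symm) = of.symm ⁻¹' criticalSet (𝓡 (n + 1)) f :=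
  Set.ext fun q => isMCriticalPt_iff (p := of.symm q)

/-- On `X` the Hessian at `p` is the second Fréchet derivative of the function read in the
extended chart. [folklore] -/
theorem mhessian_apply_eq_fderiv_fderiv (f : X → ℝ) (p : X) (v w : 𝔼 (n + 1)) :
    mhessian (𝓡 (n + 1)) f p v w =
      fderiv ℝ (fderiv ℝ (f ∘ (extChartAt (𝓡 (n + 1)) p).symm)) (extChartAt (𝓡 (n + 1)) p p) v w := by
  show (fderivWithin ℝ (fderivWithin ℝ (writtenInExtChartAt (𝓡 (n + 1)) 𝓘(ℝ, ℝ) p f)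
    (range (𝓡 (n + 1)))) (range (𝓡 (n + 1))) (extChartAt (𝓡 (n + 1)) p p) v) w = _
  rw [writtenInExtChartAt_eq, ModelWithCorners.Boundaryless.range_eq_univ (I := 𝓡 (n + 1)),
    fderivWithin_univ, fderivWithin_univ]

/-- On the synonym the Hessian at `of p` is the second Fréchet derivative of the function read
in the half-space extended chart (an interior point: derivatives within the half-space are plain
derivatives near the base point; cf. the twin lemmas for interior points in
`SPC4MorseExistence.lean` / `TrisectionsRefutation.lean`). [folklore] -/
theorem mhessian_apply_eq_fderiv_fderiv' (f : X → ℝ) (p : X) (v w : 𝔼 (n + 1)) :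
    mhessian (𝓡∂ (n + 1)) (f ∘ of.symm) (of p) v w =
      fderiv ℝ (fderiv ℝ ((f ∘ of.symm) ∘ (extChartAt (𝓡∂ (n + 1)) (of p)).symm))
        (extChartAt (𝓡∂ (n + 1)) (of p) (of p)) v w := by
  set G' := (f ∘ of.symm) ∘ (extChartAt (𝓡∂ (n + 1)) (of p)).symm
  have h1 : fderivWithin ℝ G' (range (𝓡∂ (n + 1))) =ᶠ[𝓝 (extChartAt (𝓡∂ (n + 1)) (of p) (of p))]
      fderiv ℝ G' := by
    filter_upwards [setOf_apply_zero_pos_mem_nhds p] with u hu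
    refine fderivWithin_of_mem_nhds (Filter.mem_of_superset
      ((isOpen_setOf_apply_zero_pos n).mem_nhds hu) fun z hz => ?_)
    rw [range_modelWithCornersEuclideanHalfSpace]
    exact (show (0 : ℝ) < z 0 from hz).le
  show (fderivWithin ℝ (fderivWithin ℝ (writtenInExtChartAt (𝓡∂ (n + 1)) 𝓘(ℝ, ℝ) (of p) (f ∘ of.symm))
    (range (𝓡∂ (n + 1)))) (range (𝓡∂ (n + 1))) (extChartAt (𝓡∂ (n + 1)) (of p) (of p)) v) w = _
  rw [writtenInExtChartAt_eq', h1.fderivWithin_eq_of_nhds, fderivWithin_of_mem_nhds (range_mem_nhds p)]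

/-- **The Hessians at a critical point are congruent**: at a critical point `p` of a `C²`
function `f` on `X`, the Hessian of `f` on the synonym is the Hessian of `f` on `X` composed
with the invertible linear map `D(logFirst)` at the base point (second-order chain rule, the
first-order term vanishing at a critical point; Milnor 1963, §2). [cite: Milnor1963, §2] -/
theorem mhessian_apply_eq (hf : ContMDiffAt (𝓡 (n + 1)) 𝓘(ℝ, ℝ) 2 f p)
    (hp : IsMCriticalPt (𝓡 (n + 1)) f p) (v w : 𝔼 (n + 1)) :
    mhessian (𝓡∂ (n + 1)) (f ∘ of.symm) (of p) v w =
      mhessian (𝓡 (n + 1)) f p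
        (fderiv ℝ (logFirst n) (extChartAt (𝓡∂ (n + 1)) (of p) (of p)) v)
        (fderiv ℝ (logFirst n) (extChartAt (𝓡∂ (n + 1)) (of p) (of p)) w) := by
  set G := f ∘ (extChartAt (𝓡 (n + 1)) p).symm with hG
  have hGd : ContDiffAt ℝ 2 G (extChartAt (𝓡 (n + 1)) p p) := contDiffAt_comp_extChartAt_symm hf
  have hd : MDifferentiableAt (𝓡 (n + 1)) 𝓘(ℝ, ℝ) f p := hf.mdifferentiableAt (by norm_num)
  have hcrit : fderiv ℝ G (extChartAt (𝓡 (n + 1)) p p) = 0 := by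
    rw [hG, ← mfderiv_eq_fderiv hd]; exact hp
  rw [mhessian_apply_eq_fderiv_fderiv', mhessian_apply_eq_fderiv_fderiv,
    ((comp_extChartAt_symm_eventuallyEq f p).fderiv).fderiv_eq, extChartAt_apply]
  rw [← logFirst_expFirst n (extChartAt (𝓡 (n + 1)) p p)] at hGd hcrit
  rw [fderiv_fderiv_comp_apply_of_fderiv_eq_zero hGd
    (contDiffAt_logFirst n (expFirst_apply_zero_pos n _).ne') hcrit v w, logFirst_expFirst]

/-- **Nondegeneracy of the Hessian at a critical point is the same for `X` and for the
synonym.** [cite: Milnor1963, §2] -/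
theorem nondegenerate_mhessian_iff (hf : ContMDiffAt (𝓡 (n + 1)) 𝓘(ℝ, ℝ) 2 f p)
    (hp : IsMCriticalPt (𝓡 (n + 1)) f p) :
    (mhessian (𝓡∂ (n + 1)) (f ∘ of.symm) (of p)).Nondegenerate ↔
      (mhessian (𝓡 (n + 1)) f p).Nondegenerate :=
  nondegenerate_iff_of_forall_apply_eq
    (fderivLogFirst n _ (extChartAt_apply_zero_pos p p)).toLinearEquiv
    fun v w => mhessian_apply_eq hf hp v w

/-- **The Morse index at a critical point is the same for `X` and for the synonym**
(Sylvester's law). [cite: Milnor1963, §2] -/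
theorem morseIndex_eq (hf : ContMDiffAt (𝓡 (n + 1)) 𝓘(ℝ, ℝ) 2 f p)
    (hp : IsMCriticalPt (𝓡 (n + 1)) f p) :
    morseIndex (𝓡∂ (n + 1)) (f ∘ of.symm) (of p) = morseIndex (𝓡 (n + 1)) f p :=
  sigNeg_eq_of_forall_apply_eq
    (fderivLogFirst n _ (extChartAt_apply_zero_pos p p)).toLinearEquiv
    fun v w => mhessian_apply_eq hf hp v w

/-- **Morse functions are the same for `X` and for `HalfSpaceCharted X`.** [cite: Milnor1963, §2] -/
theorem isMorse_iff : IsMorse (𝓡∂ (n + 1)) (f ∘ of.symm) ↔ IsMorse (𝓡 (n + 1)) f := by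
  constructor
  · rintro ⟨hs, hnd⟩
    have hs' : ContMDiff (𝓡 (n + 1)) 𝓘(ℝ, ℝ) ∞ f := contMDiff_iff.1 hs
    refine ⟨hs', fun p hp => ?_⟩
    have h2 : ContMDiffAt (𝓡 (n + 1)) 𝓘(ℝ, ℝ) 2 f p := (hs' p).of_le (by norm_cast)
    exact (nondegenerate_mhessian_iff h2 hp).1 (hnd (of p) (isMCriticalPt_iff.2 hp))
  · rintro ⟨hs, hnd⟩
    refine ⟨contMDiff_iff.2 hs, fun q hq => ?_⟩
    have hq' : IsMCriticalPt (𝓡 (n + 1)) f (of.symm q) := isMCriticalPt_iff.1 hq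
    have h2 : ContMDiffAt (𝓡 (n + 1)) 𝓘(ℝ, ℝ) 2 f (of.symm q) := (hs _).of_le (by norm_cast)
    exact (nondegenerate_mhessian_iff h2 hq').2 (hnd _ hq')

/-- `isMCriticalPt_iff` at a point of the synonym. [folklore] -/
theorem isMCriticalPt_iff' {q : HalfSpaceCharted X} :
    IsMCriticalPt (𝓡∂ (n + 1)) (f ∘ of.symm) q ↔ IsMCriticalPt (𝓡 (n + 1)) f (of.symm q) :=
  isMCriticalPt_iff (p := of.symm q)

/-- `morseIndex_eq` at a point of the synonym. [cite: Milnor1963, §2] -/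
theorem morseIndex_eq' {q : HalfSpaceCharted X} (hf : ContMDiffAt (𝓡 (n + 1)) 𝓘(ℝ, ℝ) 2 f (of.symm q))
    (hq : IsMCriticalPt (𝓡 (n + 1)) f (of.symm q)) :
    morseIndex (𝓡∂ (n + 1)) (f ∘ of.symm) q = morseIndex (𝓡 (n + 1)) f (of.symm q) :=
  morseIndex_eq hf hq

/-- The critical points of each index correspond (for a `C²` function). [cite: Milnor1963, §2] -/
theorem criticalSetOfIndex_eq (hf : ContMDiff (𝓡 (n + 1)) 𝓘(ℝ, ℝ) 2 f) (k : ℕ) :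
    criticalSetOfIndex (𝓡∂ (n + 1)) (f ∘ of.symm) k = of.symm ⁻¹' criticalSetOfIndex (𝓡 (n + 1)) f k := by
  ext q
  simp only [mem_criticalSetOfIndex, mem_preimage]
  constructor
  · rintro ⟨hq, hk⟩
    have hq' : IsMCriticalPt (𝓡 (n + 1)) f (of.symm q) := isMCriticalPt_iff'.1 hq
    exact ⟨hq', by rwa [morseIndex_eq' (hf _) hq'] at hk⟩
  · rintro ⟨hq, hk⟩
    exact ⟨isMCriticalPt_iff'.2 hq, by rwa [morseIndex_eq' (hf _) hq]⟩

/-- The numbers of critical points of each index agree. [cite: Milnor1963, §2] -/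
theorem ncard_criticalSetOfIndex_eq (hf : ContMDiff (𝓡 (n + 1)) 𝓘(ℝ, ℝ) 2 f) (k : ℕ) :
    (criticalSetOfIndex (𝓡∂ (n + 1)) (f ∘ of.symm) k).ncard =
      (criticalSetOfIndex (𝓡 (n + 1)) f k).ncard := by
  rw [criticalSetOfIndex_eq hf, ← Equiv.image_eq_preimage_symm,
    Set.ncard_image_of_injective _ of.injective]

end Morse

end HalfSpaceCharted

/-! ### The closed manifold as a cobordism from `∅` to `∅` -/

section OfClosed

/-- The empty type is a charted space over any model (Mathlib's `ChartedSpace.empty`, a `def`,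
registered here as an instance for `PEmpty`, the ends of the cobordism `(X; ∅, ∅)`). [folklore] -/
instance instChartedSpacePEmpty (H : Type*) [TopologicalSpace H] : ChartedSpace H PEmpty.{u + 1} :=
  ChartedSpace.empty H _

variable (n : ℕ) (X : Type u) [TopologicalSpace X] [T2Space X] [SecondCountableTopology X]
  [CompactSpace X] [ChartedSpace (𝔼 (n + 1)) X] [IsManifold (𝓡 (n + 1)) ∞ X]

open HalfSpaceCharted in
/-- **A closed `(n+1)`-manifold as a cobordism from `∅` to `∅`** (Milnor 1965, §1: a closed
manifold is a triad `(W; V₀, V₁)` with `V₀ = V₁ = ∅`; Thm. 4.8 and §§5–8 are stated for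
triads).  The total space is `HalfSpaceCharted X` — `X` with half-space charts, a compact
`C^∞` manifold with (empty) boundary — and both ends are `PEmpty`. [cite: MilnorHCobordism1965, §1 (triads; the case V₀ = V₁ = ∅)] -/
def Cobordism.ofClosed : Cobordism n PEmpty.{u + 1} PEmpty.{u + 1} where
  W := HalfSpaceCharted X
  inl := PEmpty.elim
  inr := PEmpty.elim
  isSmoothEmbedding_inl :=
    ⟨⟨PUnit, inferInstance, inferInstance, fun x => x.elim⟩, .of_subsingleton _⟩
  isSmoothEmbedding_inr :=
    ⟨⟨PUnit, inferInstance, inferInstance, fun x => x.elim⟩, .of_subsingleton _⟩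
  disjoint_range := by simp [Set.range_eq_empty]
  range_inl_union_range_inr := by
    rw [HalfSpaceCharted.boundary_eq_empty]; simp [Set.range_eq_empty]

/-- The total space of `Cobordism.ofClosed n X` is `HalfSpaceCharted X`. [folklore] -/
theorem Cobordism.ofClosed_W : (Cobordism.ofClosed n X).W = HalfSpaceCharted X := rfl

/-- The total space of `(X; ∅, ∅)` is connected when `X` is. [folklore] -/
instance [ConnectedSpace X] : ConnectedSpace (Cobordism.ofClosed n X).W := ‹ConnectedSpace X›

/-- The total space of `(X; ∅, ∅)` is nonempty when `X` is. [folklore] -/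
instance [Nonempty X] : Nonempty (Cobordism.ofClosed n X).W := ‹Nonempty X›

/-- The total space of `(X; ∅, ∅)` has no boundary points. [folklore] -/
instance : BoundarylessManifold (𝓡∂ (n + 1)) (Cobordism.ofClosed n X).W :=
  HalfSpaceCharted.instBoundarylessManifold (n := n) (X := X)

variable {n X}

open HalfSpaceCharted in
/-- **Morse functions on the cobordism `(X; ∅, ∅)`** (`Literature.Topology.FourManifolds.Cobordism.IsMorseFunction`: Morse
for `𝓡∂`, the boundary conditions, values in `(0, 1)` on the interior) are exactly the Morse
functions on `X` with values in `(0, 1)`: the boundary is empty and the interior is everything.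
[cite: MilnorHCobordism1965, Def. 3.1 (the case V = V' = ∅)] -/
theorem Cobordism.isMorseFunction_ofClosed_iff {f : X → ℝ} :
    (Cobordism.ofClosed n X).IsMorseFunction (f ∘ of.symm) ↔
      IsMorse (𝓡 (n + 1)) f ∧ ∀ x, f x ∈ Ioo 0 1 := by
  constructor
  · rintro ⟨hM, -, -, -, hI⟩
    refine ⟨(isMorse_iff (n := n) (X := X) (f := f)).1 hM, fun x => hI (of x) ?_⟩
    show of x ∈ (𝓡∂ (n + 1)).interior (HalfSpaceCharted X)
    rw [HalfSpaceCharted.interior_eq_univ]; trivial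
  · rintro ⟨hM, hI⟩
    refine ⟨(isMorse_iff (n := n) (X := X) (f := f)).2 hM, fun x => x.elim, fun y => y.elim,
      fun z hz => ?_, fun z _ => hI (of.symm z)⟩
    have hz' : z ∈ (𝓡∂ (n + 1)).boundary (HalfSpaceCharted X) := hz
    rw [boundary_eq_empty] at hz'
    exact hz'.elim

end OfClosed

end Literature.Topology.FourManifolds
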